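import Mathlib
import Summits.HodgeConjecture.HodgeConjecture.Theses.CyclicUnitaryPowers
import Literature.NumberTheory.LFunctions.MailletKernelBalanced

/-!
# `DetSupportsBalanced` holds (route CyclicUnitaryPowers, item stmt-HodgeConjecture-19546)

The support item `DetSupportsBalanced` of route `route-HodgeConjecture-CyclicUnitaryPowers`
(Galois-stable determinant supports are balanced: if `c ≠ 0` and
`∑_{j ∈ [1,p)} m(j)·c·(p − 2·(t·j mod p)) = 0` for every `1 ≤ t < p`, then `m(j) = m(p − j)`)
is, verbatim, the landed Literature theorem
`Literature.NumberTheory.LFunctions.MailletKernel.balanced_of_sum_mul_residueWeight_eq_zero`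
(Maillet's determinant / `B_{1,ψ} ≠ 0` for odd `ψ`; [CarlitzOlson1955], [Washington1997, Thm 4.2, §4]),
which holds for every prime `p` (the item only asks `p ≥ 7`).
-/

namespace Summit.HodgeConjecture.HodgeConjecture.Theorems

/-- The support item `DetSupportsBalanced` of route `CyclicUnitaryPowers` holds: a one-line
application of `MailletKernel.balanced_of_sum_mul_residueWeight_eq_zero`. -/
theorem detSupportsBalanced_holds :
    Summit.HodgeConjecture.HodgeConjecture.Theses.CyclicUnitaryPowers.DetSupportsBalanced :=
  fun _p _ hp c hc m h =>
    Literature.NumberTheory.LFunctions.MailletKernel.balanced_of_sum_mul_residueWeight_eq_zero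
      hp c hc m h

end Summit.HodgeConjecture.HodgeConjecture.Theorems
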